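import Summits.PneNP.PneNP.Theorems.RegularResolutionRung.Negative.OneSidedFalse
import Summits.PneNP.PneNP.Theorems.RamseyUncertifiableRegularResolutionRungBanksDefs
import Mathlib.Analysis.SpecialFunctions.Log.Base
import Mathlib.Analysis.SpecialFunctions.Pow.Real

/-!
# `stub_bankEntropy` (= `BoundedOneWidthLB`, line `indelible-zero-banks` of crux `RegularResolutionRung`,
stmt-PneNP-9818): the LOWER half of bi-density is load-bearing

drefute seat `refuter-drefute-stmt-PneNP-9818-g4-0` (generation 4, 2026-08-16). Negative lemma for the
registered stub `stub_bankEntropy` of skeleton `Lines/indelible_zero_banks.lean` (sha `40f94228…`), whose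
statement is the body of `IndelibleZeroBanks.BoundedOneWidthLB`:

  for all `β, δ, C` there are `γ, ε > 0`, `m₀` such that on every symmetric irreflexive `adj` on `m ≥ m₀`
  vertices that is TWO-SIDED bi-dense (`BiDense adj M δ = LowerDense ∧ UpperDense`) at a scale `M` with
  `log₂ M ≤ (1-β) log₂ m`, every regular refutation of `Clique(adj,k)`, `k ≤ C log₂ m`, all of whose
  clauses have one-width `≤ γ log₂ m`, has `log₂ |π| ≥ ε log₂² m`.

* `BoundedOneWidthLBWithoutLower` — the same statement with `BiDense` weakened to `UpperDense` (the
  Prömel–Rödl half this line's card calls "the engine").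
* `boundedOneWidthLB_false_without_lower : ¬ BoundedOneWidthLBWithoutLower` — FALSE: the EMPTY graph is
  upper-dense at every scale, and the tree's explicit regular refutation `Negative.refutation m` of
  `Clique(∅ₘ, 2)` (`2m² + m + 2` lines, `EmptyGraphLines.lean` / `OneSidedFalse.lean`) has ONE-WIDTH ≤ 2
  (`card_negSupport_line_le_two`: its clauses are block clauses, edge axioms `¬x_{0,t} ∨ ¬x_{1,s}` and the
  chains `x_{0,t+1} ∨ … ∨ x_{0,m-1} ∨ ¬x_{1,s}`, `x_{1,s+1} ∨ … ∨ x_{1,m-1}`), so it satisfies the one-width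
  hypothesis for every `γ > 0` once `γ log₂ m ≥ 2`, while `log₂(2m²+m+2) < ε log₂² m` eventually
  (`Negative.key_bound`). Hence any proof of the stub must use LOWER density (in the line: `junkSetSmall`,
  and the existence of `Θ(log m)`-cliques); upper density + symmetry + small one-width alone do not force
  long regular refutations.
* `card_negSupport_le` — one-width is at most the number of negative literals (generic; reusable by the
  `stub_oneWidthNF`/`stub_restrict` consumers).

Paper complements (not formalised here; drefute notes `Cruxes/RegularResolutionRung/NegativeNotes-*`): dropping SYMMETRY
is false (a bi-dense tournament `(u<v) ? S(u,v) : (v<u) ? ¬S(v,u) : false` over a two-sided bi-dense symmetric `S` has exactly the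
clause set of the empty graph, so `refutation m` refutes it; bi-density at scale `m^{1-β}`, `β < 1/4`, by an interval
decomposition of the order); dropping the ONE-WIDTH bound gives `BiDenseRegularLB` (C⁺), EQUIVALENT to the stub via the
landed `stub_oneWidthNF` — so the one-width hypothesis is NOT load-bearing; dropping IRREFLEXIVITY only adds vacuous
instances; dropping REGULARITY gives the general-resolution question, open (ABdRLNR21 §9). Whether UPPER density is
load-bearing is NOT known to us: the usual separating examples (Turán `T(m,k-1)`, complete joins of few parts) violate
LOWER density at scale `m^{1-β}` as well (independent or sparse parts of size `≥ m/k ≫ M`), ABdRLNR21's clique-denseness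
is itself a one-sided (lower-type) hypothesis, and no lower-dense `K_k`-free family with short regular refutations is
known — the one-sided statement is as open as the two-sided one. [folklore]
-/

noncomputable section

open scoped Classical

namespace Summit.PneNP.PneNP.Cruxes.RegularResolutionRung.IndelibleZeroBanks

open Finset
open Literature.Computability.MetaComplexity Literature.Computability.Complexity
open Summit.PneNP.PneNP.Theorems.RegularResolutionRung.Negative

set_option linter.dupNamespace false -- `Summit.PneNP.PneNP.…` (single-conjunct summit, D-0017)

/-- `BoundedOneWidthLB` (the registered statement of `stub_bankEntropy`) with the two-sided `BiDense adj M δ`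
weakened to its UPPER half `UpperDense adj M δ`. -/
def BoundedOneWidthLBWithoutLower : Prop :=
  ∀ β δ C : ℝ, 0 < β → β < 1 → 0 < δ → 0 < C →
    ∃ γ : ℝ, 0 < γ ∧ ∃ ε : ℝ, 0 < ε ∧ ∃ m₀ : ℕ, ∀ m : ℕ, m₀ ≤ m →
      ∀ (adj : Fin m → Fin m → Bool), (∀ u v, adj u v = adj v u) → (∀ u, adj u u = false) →
      ∀ M : ℕ, Real.logb 2 M ≤ (1 - β) * Real.logb 2 m → UpperDense adj M δ →
      ∀ k : ℕ, (k : ℝ) ≤ C * Real.logb 2 m →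
      ∀ π : List (ResLine ℕ), IsResRefutation (cliqueCNF m k adj) π → IsRegular π →
        (∀ l ∈ π, ((negSupport m k l.clause).card : ℝ) ≤ γ * Real.logb 2 m) →
        ε * Real.logb 2 m ^ 2 ≤ Real.logb 2 π.length

/-- One-width is at most the number of negative literals of the clause: `v ↦` (a witnessing literal
`¬x_{i,v}`) `↦ (i·n+v) % n = v` recovers `v`. -/
theorem card_negSupport_le (n k : ℕ) (C : Finset (Literal ℕ)) :
    (negSupport n k C).card ≤ (C.filter fun x => x.2 = false).card := by
  calc (negSupport n k C).card = ((negSupport n k C).map Fin.valEmbedding).card := (card_map _).symm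
    _ ≤ ((C.filter fun x => x.2 = false).image fun x => x.1 % n).card := by
        refine card_le_card fun a ha => ?_
        obtain ⟨v, hv, rfl⟩ := mem_map.1 ha
        obtain ⟨i, -, hi⟩ := (mem_filter.1 hv).2
        refine mem_image.2 ⟨(i * n + (v : ℕ), false), mem_filter.2 ⟨hi, rfl⟩, ?_⟩
        have hvn : (v : ℕ) < n := v.isLt
        show (i * n + (v : ℕ)) % n = Fin.valEmbedding v
        rw [Fin.valEmbedding_apply, Nat.add_comm, Nat.add_mul_mod_self_right, Nat.mod_eq_of_lt hvn]
    _ ≤ (C.filter fun x => x.2 = false).card := card_image_le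

/-- `pos0` contains no negative literal. -/
theorem filter_neg_pos0 (lo n : ℕ) : ((pos0 lo n).filter fun x => x.2 = false) = ∅ := by
  ext x
  simp only [mem_filter, mem_pos0, Finset.notMem_empty, iff_false, not_and]
  intro h
  rw [h.2.2]
  decide

/-- `pos1` contains no negative literal. -/
theorem filter_neg_pos1 (lo n : ℕ) : ((pos1 lo n).filter fun x => x.2 = false) = ∅ := by
  ext x
  simp only [mem_filter, mem_pos1, Finset.notMem_empty, iff_false, not_and]
  intro h
  rw [h.2.2]
  decide

/-- The clause of line `a` of `refutation n` is a block clause, an edge axiom `clE`, an inner-chain clause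
`clR`, or an outer-chain clause `pos1 lo n`. -/
theorem clause_line_cases (n a : ℕ) :
    (line n a).clause = pos1 0 n ∨ (line n a).clause = pos0 0 n ∨
      (∃ t s, (line n a).clause = clE n t s) ∨ (∃ s t, (line n a).clause = clR n s t) ∨
      (∃ lo, (line n a).clause = pos1 lo n) := by
  unfold line
  split_ifs
  all_goals first
    | exact Or.inl rfl
    | exact Or.inr (Or.inl rfl)
    | exact Or.inr (Or.inr (Or.inl ⟨_, _, rfl⟩))
    | exact Or.inr (Or.inr (Or.inr (Or.inl ⟨_, _, rfl⟩)))
    | exact Or.inr (Or.inr (Or.inr (Or.inr ⟨_, rfl⟩)))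

/-- Every clause of the explicit refutation `refutation n` of `Clique(∅ₙ,k)` has at most two negative
literals (block clauses: 0; edge axioms `clE`: 2; inner chain `clR`: 1; outer chain: 0). -/
theorem card_filter_neg_line_le_two (n a : ℕ) :
    (((line n a).clause).filter fun x => x.2 = false).card ≤ 2 := by
  rcases clause_line_cases n a with h | h | ⟨t, s, h⟩ | ⟨s, t, h⟩ | ⟨lo, h⟩ <;> rw [h]
  · simp [filter_neg_pos1]
  · simp [filter_neg_pos0]
  · -- edge axiom: exactly the two negative literals
    refine (card_le_card (filter_subset _ _)).trans ?_
    exact (card_insert_le _ _).trans (by simp)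
  · -- inner chain: `pos0 (t+1) n ∪ {¬x_{1,s}}`
    simp only [clR, filter_union, filter_neg_pos0, empty_union]
    exact (card_le_card (filter_subset _ _)).trans (by simp)
  · simp [filter_neg_pos1]

/-- ONE-WIDTH ≤ 2 for every clause of `refutation n`, for every block count `k`. -/
theorem card_negSupport_line_le_two (n k a : ℕ) : (negSupport n k (line n a).clause).card ≤ 2 :=
  (card_negSupport_le n k _).trans (card_filter_neg_line_le_two n a)

/-- **Lower density is load-bearing for `stub_bankEntropy`.** With `BiDense` weakened to `UpperDense`
the statement is FALSE: witness the empty graph (`adj ≡ false`, symmetric, irreflexive, upper-dense at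
every scale, here `M = 1`), `k = 2 ≤ C log₂ m`, and the regular refutation `refutation m` with `2m²+m+2`
lines and one-width ≤ 2 `≤ γ log₂ m`; but `log₂(2m²+m+2) < ε log₂² m` for the `m = 2^j` of `key_bound`. -/
theorem boundedOneWidthLB_false_without_lower : ¬ BoundedOneWidthLBWithoutLower := by
  intro h
  obtain ⟨γ, hγ, ε, hε, m₀, hmain⟩ :=
    h (1 / 2) (1 / 2) 2 (by norm_num) (by norm_num) (by norm_num) (by norm_num)
  -- a large `m = 2^j`: beyond `m₀`, beyond `2^(⌈2/γ⌉₊+1)` (so that `γ log₂ m ≥ 2`), with the length bound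
  obtain ⟨m, hm₀, hm1, -, hlt⟩ := key_bound hε (max m₀ (2 ^ (⌈2 / γ⌉₊ + 1)))
  have hmm₀ : m₀ ≤ m := le_trans (le_max_left _ _) hm₀
  have hpow : 2 ^ (⌈2 / γ⌉₊ + 1) ≤ m := le_trans (le_max_right _ _) hm₀
  have hmR : (0 : ℝ) < m := by exact_mod_cast hm1
  set L : ℝ := Real.logb 2 m with hLdef
  -- `L ≥ ⌈2/γ⌉₊ + 1 ≥ 2/γ`, `L ≥ 1`
  have hLge : ((⌈2 / γ⌉₊ + 1 : ℕ) : ℝ) ≤ L := by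
    have h1 : Real.logb 2 ((2 ^ (⌈2 / γ⌉₊ + 1) : ℕ) : ℝ) = ((⌈2 / γ⌉₊ + 1 : ℕ) : ℝ) := by
      push_cast
      rw [← Real.rpow_natCast, Real.logb_rpow (by norm_num) (by norm_num)]
      push_cast; ring
    rw [← h1, hLdef]
    exact Real.logb_le_logb_of_le one_lt_two (by positivity) (by exact_mod_cast hpow)
  have hceil : 2 / γ ≤ (⌈2 / γ⌉₊ : ℝ) := Nat.le_ceil _
  have hL2γ : 2 / γ + 1 ≤ L := by push_cast at hLge; linarith
  have hL1 : 1 ≤ L := by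
    have : 0 ≤ 2 / γ := by positivity
    linarith
  have hγL : 2 ≤ γ * L := by
    have h2 : 2 / γ ≤ L := by linarith
    rw [div_le_iff₀ hγ] at h2
    linarith
  -- the witness instance
  have hsymm : ∀ u v : Fin m, (fun _ _ : Fin m => false) u v = (fun _ _ : Fin m => false) v u :=
    fun _ _ => rfl
  have hirr : ∀ u : Fin m, (fun _ _ : Fin m => false) u u = false := fun _ => rfl
  have hM : Real.logb 2 ((1 : ℕ) : ℝ) ≤ (1 - 1 / 2) * Real.logb 2 m := by
    rw [Nat.cast_one, Real.logb_one, ← hLdef]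
    linarith
  have hup : UpperDense (fun _ _ : Fin m => false) 1 (1 / 2) := by
    intro A B _ _
    have h0 : edgeCount (fun _ _ : Fin m => false) A B = 0 := by simp [edgeCount]
    rw [h0, Nat.cast_zero]
    positivity
  have hkC : ((2 : ℕ) : ℝ) ≤ 2 * Real.logb 2 m := by
    rw [← hLdef]; push_cast; linarith
  have hwidth : ∀ l ∈ refutation m, ((negSupport m 2 l.clause).card : ℝ) ≤ γ * Real.logb 2 m := by
    intro l hl
    obtain ⟨a, -, rfl⟩ := List.mem_map.1 hl
    have h2 : ((negSupport m 2 (line m a).clause).card : ℝ) ≤ 2 := by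
      exact_mod_cast card_negSupport_line_le_two m 2 a
    rw [← hLdef]
    exact h2.trans hγL
  have key := hmain m hmm₀ (fun _ _ => false) hsymm hirr 1 hM hup 2 hkC (refutation m)
    (refutation_isResRefutation hm1 le_rfl) (refutation_isRegular hm1) hwidth
  -- `log₂ |π| < ε L²`
  rw [length_refutation] at key
  have hlenpos : (0 : ℝ) < ((2 + 2 * (m * m) + m : ℕ) : ℝ) := by positivity
  have hlog : Real.logb 2 ((2 + 2 * (m * m) + m : ℕ) : ℝ) < ε * L ^ 2 := by
    calc Real.logb 2 ((2 + 2 * (m * m) + m : ℕ) : ℝ)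
        < Real.logb 2 ((m : ℝ) ^ (ε * Real.logb 2 m)) := Real.logb_lt_logb one_lt_two hlenpos hlt
      _ = ε * Real.logb 2 m * Real.logb 2 m := Real.logb_rpow_eq_mul_logb_of_pos hmR
      _ = ε * L ^ 2 := by rw [hLdef]; ring
  exact absurd (key.trans_lt hlog) (lt_irrefl _)

end Summit.PneNP.PneNP.Cruxes.RegularResolutionRung.IndelibleZeroBanks

end
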